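import Summits.QuantumFields.Balaban3D.Proofs.GroupModelSkew
import Mathlib.Analysis.InnerProductSpace.PiL2
import Mathlib.Analysis.InnerProductSpace.Dual
import Mathlib.Analysis.Normed.Module.Dual

/-!
# `Summit.QuantumFields.Balaban3D.Proofs.GroupModelLieC` — the complexified Lie algebra `𝔤ᶜ` of the lane's group model as a
# finite-dimensional complex inner product space with the adjoint action, and THE DETECTING PROPERTY («the only element
# invariant is 0», [Balaban1985UV3] p. 264 L6–7) IN THE COVECTOR FORM consumed by seat p6's
# `…Proofs.Eq32FromInvariance.fderiv_eq_zero_of_diagInvariant` / `detecting_pi` / `…Run3Representation.eq32_of_inv26`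
# (lane ruling R-32, batches 9/11 (b)) — lane `pub-balaban3d`, seat p4

HONEST FRAMING (lane PLAN.md §0, binding): see `…Proofs.SectAFirstStep`.  Nothing of [Balaban1985UV3] beyond the quoted
Lie-algebra sentence of p. 264 is touched; NOT a construction of 𝒫′₁ or of the charts (29).

WHAT IS PRINTED.  p. 264 = PDF 10 L4–12 (render `…/1985-cmp102-uv-stability-3d/…-p010-x2.png`): «The gauge invariance (26)
implies the invariance with respect to the global transformations R(U), U ∈ G, hence the equality (31) … The derivative in
the above formula is an element of the Lie algebra 𝔤, and by the assumption that 𝔤 is semi-simple, the only element invariant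
is 0, and we conclude (32) … It is the only place we use the semi-simplicity».  Seat p6 reads (31) ⇒ (32) in the CHART SPACE
of (29) (variables `𝓗(b) ∈ 𝔤ᶜ` per bond, complex-analytic charts): its theorems take the DETECTING PROPERTY of the bond
space `V` in covector form, `∀ φ : V →L[ℂ] F, (∀ U, φ ∘ π U = φ) → φ = 0`.  THIS FILE SUPPLIES THAT HYPOTHESIS for
`V = 𝔤ᶜ` and `π U = Ad(ρ U)` from the spine's group model AS TYPED (`Setting.GroupModel`: `ρ(G) ⊂ U(N)` closed, `𝔤 = {X :
exp tX ∈ ρ(G)}` real semisimple) — i.e. from REAL semisimplicity of 𝔤 plus unitarity, WITHOUT assuming that the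
complexification 𝔤ᶜ is complex-semisimple (the route of LQB `B13DerivZeroGauge.derivZeroAlongV_of_semisimple` needs
`LieAlgebra.IsSemisimple ℂ 𝔤ᶜ`, «classical, not re-derived» there).

WHAT THIS FILE PROVES (no `sorry`, axioms standard):
* §1 [folklore] the UNITARY TRICK in covector form, abstractly: in a finite-dimensional complex inner product space, for a
  family of maps `π U` whose «adjoints stay in the family» (`⟪π U x, y⟫ = ⟪x, π U' y⟫`), NO non-zero invariant vector ⇒ NO
  non-zero invariant continuous linear map into any complex normed space (`invariantCLM_eq_zero_of_forall_inner`; Riesz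
  `InnerProductSpace.toDual` + Hahn–Banach `SeparatingDual`).
* §2 the CARRIER `lieC M : Submodule ℂ (EuclideanSpace ℂ (Fin N × Fin N))` = the vectorised `span_ℂ 𝔤` (so that `↥(lieC M)` is
  a complex inner product space with the Frobenius product `⟪x, y⟫ = tr(xᴴy)` (`inner_vecE`), finite-dimensional, complete —
  all instances inherited from Mathlib, none declared here), the adjoint action `adC M U : ↥(lieC M) →L[ℂ] ↥(lieC M)`
  (`v ↦ ρ(U) v ρ(U)ᴴ`, well defined by `GroupModelSkew.conj_mem_lie`), `inner_adC_left` (`⟪Ad(U)x, y⟫ = ⟪x, Ad(U⁻¹)y⟫`: the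
  Frobenius product is `Ad`-invariant for unitary `ρ(U)`), `adC_eq_self_imp` (no fixed vectors, = `GroupModelSkew.
  eq_zero_of_mem_span_of_conj_eq`), and
* §3 **`hdet_lieC`**: `∀ φ : ↥(lieC M) →L[ℂ] F, (∀ U, φ.comp (adC M U) = φ) → φ = 0` — literally the `hdet` binder of
  `…Proofs.Eq32FromInvariance.fderiv_eq_zero_of_diagInvariant` / `detecting_pi` / `…Run3Representation.eq32_of_inv26` at
  `V := ↥(lieC M)`, `π := adC M` (checked by `example` against seat p6's file 0cd14692 in this seat's scratch); `hdet_lieC_pi` the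
  same for the diagonal action on a chart space `ι → 𝔤ᶜ`.  CONSEQUENCE for the end theorem (R-32): IF the expansion data pin
  the chart space of (29) to `E := (bonds) → ↥(lieC M)` with the diagonal action `fun U => ContinuousLinearMap.pi fun b =>
  (adC M U).comp (proj b)`, the detecting hypothesis of C5/C7 is DISCHARGED (`Eq32FromInvariance.detecting_pi (adC M)
  (hdet_lieC M)`); for an ABSTRACT chart space `E` it necessarily stays a hypothesis about `E` (false for a trivial action).
-/

noncomputable section

namespace Summit.QuantumFields.Balaban3D.Proofs.GroupModelLieC

open Literature.MathematicalPhysics.QuantumFieldTheory.Balaban1983to89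
open Literature.MathematicalPhysics.QuantumFieldTheory.Balaban1985CMP102.Setting (GroupModel)
open Summit.QuantumFields.Balaban3D.Proofs.GroupModelSkew
open scoped InnerProductSpace ComplexConjugate

/-! ## §1 The unitary trick, covector form (abstract) -/

section abstract

variable {V : Type*} [NormedAddCommGroup V] [InnerProductSpace ℂ V] [FiniteDimensional ℂ V]
  {F : Type*} [NormedAddCommGroup F] [NormedSpace ℂ F] {Γ : Type*}

/-- [folklore] **Unitary trick, covector form.**  `π : Γ → V →L[ℂ] V` a family of maps of a finite-dimensional complex
inner product space such that for every `U` some `U'` satisfies `⟪π U x, y⟫ = ⟪x, π U' y⟫` (e.g. a unitary representation of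
a group: `U' = U⁻¹`).  If `V` has no non-zero vector fixed by all `π U`, then every continuous linear map `φ : V → F` into a
complex normed space with `φ ∘ π U = φ` for all `U` is `0`.  Proof: for each functional `ψ` on `F`, Riesz-represent
`ψ ∘ φ = ⟪w, ·⟫`; invariance makes `w` a fixed vector, so `w = 0`; Hahn–Banach separates. [folklore] -/
theorem invariantCLM_eq_zero_of_forall_inner (π : Γ → V →L[ℂ] V)
    (hadj : ∀ U, ∃ U', ∀ x y : V, ⟪π U x, y⟫_ℂ = ⟪x, π U' y⟫_ℂ)
    (hvec : ∀ w : V, (∀ U, π U w = w) → w = 0)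
    (φ : V →L[ℂ] F) (hφ : ∀ U, φ.comp (π U) = φ) : φ = 0 := by
  haveI : CompleteSpace V := FiniteDimensional.complete ℂ V
  ext v
  show φ v = 0
  refine SeparatingDual.eq_zero_of_forall_dual_eq_zero (R := ℂ) fun ψ => ?_
  -- Riesz representation of the invariant scalar functional `ψ ∘ φ`
  set χ : V →L[ℂ] ℂ := ψ.comp φ with hχ
  set w : V := (InnerProductSpace.toDual ℂ V).symm χ with hw
  have hwv : ∀ x : V, ⟪w, x⟫_ℂ = χ x := fun x => by
    rw [hw, InnerProductSpace.toDual_symm_apply]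
  have hχinv : ∀ U (x : V), χ (π U x) = χ x := fun U x => by
    have := congrArg (fun S : V →L[ℂ] F => S x) (hφ U)
    simp only [ContinuousLinearMap.comp_apply] at this
    rw [hχ, ContinuousLinearMap.comp_apply, ContinuousLinearMap.comp_apply, this]
  -- `w` is a fixed vector: test `π U w - w` against itself
  have hfix : ∀ U, π U w = w := fun U => by
    obtain ⟨U', hU'⟩ := hadj U
    have hzero : ∀ y : V, ⟪π U w - w, y⟫_ℂ = 0 := fun y => by
      rw [inner_sub_left, hU' w y, hwv, hwv, hχinv U' y, sub_self]
    have := hzero (π U w - w)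
    rwa [inner_self_eq_zero, sub_eq_zero] at this
  have hw0 : w = 0 := hvec w hfix
  have : χ v = 0 := by rw [← hwv v, hw0, inner_zero_left]
  simpa [hχ] using this

end abstract

/-! ## §2 The carrier `𝔤ᶜ` as a complex inner product space, the adjoint action, `Ad`-invariance of the Frobenius product -/

section carrier

variable {G : Type} [GaugeGroup G] [MeasurableSpace G]

/-- Vectorisation `M_N(ℂ) → ℂ^{N×N}` into Mathlib's Euclidean space (so that the Frobenius inner product `tr(xᴴy)` and all
inner-product-space instances are inherited). [folklore] -/
def vecE (N : ℕ) : Matrix (Fin N) (Fin N) ℂ →ₗ[ℂ] EuclideanSpace ℂ (Fin N × Fin N) where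
  toFun v := WithLp.toLp 2 fun p => v p.1 p.2
  map_add' v w := by ext p; simp
  map_smul' c v := by ext p; simp

/-- Inverse vectorisation `ℂ^{N×N} → M_N(ℂ)`. [folklore] -/
def unvecE (N : ℕ) : EuclideanSpace ℂ (Fin N × Fin N) →ₗ[ℂ] Matrix (Fin N) (Fin N) ℂ where
  toFun x := Matrix.of fun i j => x (i, j)
  map_add' x y := by ext i j; simp
  map_smul' c x := by ext i j; simp

/-- `unvecE (vecE X) = X` (the vectorisation is a linear equivalence). [folklore] -/
@[simp] theorem unvecE_vecE {N : ℕ} (v : Matrix (Fin N) (Fin N) ℂ) : unvecE N (vecE N v) = v := by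
  ext i j; simp [vecE, unvecE]

/-- `vecE (unvecE v) = v`. [folklore] -/
@[simp] theorem vecE_unvecE {N : ℕ} (x : EuclideanSpace ℂ (Fin N × Fin N)) : vecE N (unvecE N x) = x := by
  ext p; simp [vecE, unvecE]

/-- Coordinates of the vectorisation: `vecE X (i, j) = X i j`. [folklore] -/
theorem vecE_apply {N : ℕ} (v : Matrix (Fin N) (Fin N) ℂ) (p : Fin N × Fin N) : vecE N v p = v p.1 p.2 := rfl

/-- The Euclidean inner product of vectorised matrices is the Frobenius product `tr(xᴴ y)`. [folklore] -/
theorem inner_vecE {N : ℕ} (x y : Matrix (Fin N) (Fin N) ℂ) :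
    ⟪vecE N x, vecE N y⟫_ℂ = Matrix.trace (x.conjTranspose * y) := by
  rw [PiLp.inner_apply, Matrix.trace]
  simp only [vecE_apply, Matrix.diag_apply, Matrix.mul_apply, Matrix.conjTranspose_apply,
    RCLike.inner_apply', Complex.star_def]
  rw [Fintype.sum_prod_type]
  exact Finset.sum_comm

/-- **The carrier `𝔤ᶜ`** of the chart variables `𝓗(b)` ((27)–(29) p. 263: «𝓗(B) … with values in 𝔤ᶜ»), for the lane's group
model: the complex span of the vectorised Lie algebra `𝔤 = M.lie` inside `EuclideanSpace ℂ (Fin N × Fin N)`; as a type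
`↥(lieC M)` it is a finite-dimensional complex inner product space (Frobenius product, `inner_vecE`). [cite: Balaban1985UV3, (27)–(29) p.263] -/
def lieC (M : GroupModel G) : Submodule ℂ (EuclideanSpace ℂ (Fin M.N × Fin M.N)) :=
  Submodule.span ℂ (vecE M.N '' (M.lie : Set (Matrix (Fin M.N) (Fin M.N) ℂ)))

variable (M : GroupModel G)

/-- `𝔤ᶜ` is the image of the complex span of `𝔤` under the vectorisation. [folklore] -/
theorem lieC_eq_map : lieC M = (Submodule.span ℂ (M.lie : Set (Matrix (Fin M.N) (Fin M.N) ℂ))).map (vecE M.N) := by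
  rw [lieC, Submodule.map_span]

/-- An element of `𝔤ᶜ` un-vectorises into the complex span of `𝔤`. [folklore] -/
theorem unvecE_mem_span_of_mem_lieC {x : EuclideanSpace ℂ (Fin M.N × Fin M.N)} (hx : x ∈ lieC M) :
    unvecE M.N x ∈ Submodule.span ℂ (M.lie : Set (Matrix (Fin M.N) (Fin M.N) ℂ)) := by
  rw [lieC_eq_map, Submodule.mem_map] at hx
  obtain ⟨v, hv, rfl⟩ := hx
  rwa [unvecE_vecE]

/-- The vectorisation of an element of the complex span of `𝔤` lies in `𝔤ᶜ`. [folklore] -/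
theorem vecE_mem_lieC_of_mem_span {v : Matrix (Fin M.N) (Fin M.N) ℂ}
    (hv : v ∈ Submodule.span ℂ (M.lie : Set (Matrix (Fin M.N) (Fin M.N) ℂ))) : vecE M.N v ∈ lieC M := by
  rw [lieC_eq_map]; exact Submodule.mem_map_of_mem hv

/-- `𝔤 ↪ 𝔤ᶜ`: an element of the (real) Lie algebra as a vector of the carrier. [folklore] -/
theorem vecE_mem_lieC_of_mem_lie {X : Matrix (Fin M.N) (Fin M.N) ℂ} (hX : X ∈ M.lie) : vecE M.N X ∈ lieC M :=
  Submodule.subset_span ⟨X, hX, rfl⟩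

/-- The conjugation `v ↦ ρ(U) v ρ(U)ᴴ` on `M_N(ℂ)`, transported to the vectorised space, as a complex-linear map. [folklore] -/
def conjE (U : G) : EuclideanSpace ℂ (Fin M.N × Fin M.N) →ₗ[ℂ] EuclideanSpace ℂ (Fin M.N × Fin M.N) :=
  (vecE M.N).comp (((LinearMap.mulLeft ℂ (M.ρ U)).comp (LinearMap.mulRight ℂ (star (M.ρ U)))).comp (unvecE M.N))

/-- The conjugation action on vectors, unfolded: `conjE M U v = vecE (ρ(U) · unvecE v · ρ(U)⋆)`. [folklore] -/
theorem conjE_apply (U : G) (x : EuclideanSpace ℂ (Fin M.N × Fin M.N)) :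
    conjE M U x = vecE M.N (M.ρ U * (unvecE M.N x * star (M.ρ U))) := rfl

/-- `conjE M U (vecE X) = vecE (ρ(U) X ρ(U)⋆)`. [folklore] -/
theorem conjE_vecE (U : G) (v : Matrix (Fin M.N) (Fin M.N) ℂ) :
    conjE M U (vecE M.N v) = vecE M.N (M.ρ U * v * star (M.ρ U)) := by
  rw [conjE_apply, unvecE_vecE, mul_assoc]

/-- The conjugation action preserves `𝔤ᶜ` (`Ad(ρU)𝔤 ⊆ 𝔤`, complexified). [folklore] -/
theorem conjE_mem_lieC (U : G) {x : EuclideanSpace ℂ (Fin M.N × Fin M.N)} (hx : x ∈ lieC M) : conjE M U x ∈ lieC M := by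
  -- `Ad(U)` maps `span 𝔤` into itself because it maps `𝔤` into `𝔤`
  have key : ∀ y ∈ Submodule.span ℂ (M.lie : Set (Matrix (Fin M.N) (Fin M.N) ℂ)),
      M.ρ U * y * star (M.ρ U) ∈ Submodule.span ℂ (M.lie : Set (Matrix (Fin M.N) (Fin M.N) ℂ)) := by
    intro y hy
    induction hy using Submodule.span_induction with
    | mem y hy => exact Submodule.subset_span (conj_mem_lie M hy U)
    | zero => simp
    | add y z _ _ hy hz => rw [mul_add, add_mul]; exact Submodule.add_mem _ hy hz
    | smul c y _ hy => rw [Matrix.mul_smul, Matrix.smul_mul]; exact Submodule.smul_mem _ c hy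
  rw [conjE_apply, ← mul_assoc]
  exact vecE_mem_lieC_of_mem_span M (key _ (unvecE_mem_span_of_mem_lieC M hx))

/-- **The adjoint action `Ad(ρ U)` on `𝔤ᶜ`** as a continuous complex-linear map of the carrier (finite dimension ⇒
continuity is automatic): «the global transformations R(U), U ∈ G» of (31) p. 264 acting on one bond variable.
[cite: Balaban1985UV3, (31) p.264] -/
def adC (U : G) :
    ↥(lieC M) →L[ℂ] ↥(lieC M) :=
  LinearMap.toContinuousLinearMap ((conjE M U).restrict fun _ hx => conjE_mem_lieC M U hx)

/-- `adC M U` acts on `𝔤ᶜ` by `conjE` (coercion lemma). [folklore] -/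
theorem coe_adC_apply (U : G) (x : ↥(lieC M)) :
    ((adC M U x : ↥(lieC M)) : EuclideanSpace ℂ (Fin M.N × Fin M.N)) = conjE M U x := rfl

/-- **`Ad`-invariance of the Frobenius product**: `⟪Ad(U)x, y⟫ = ⟪x, Ad(U⁻¹)y⟫` on `𝔤ᶜ` (cyclicity of the trace and
`ρ(U)ᴴ = ρ(U⁻¹)`), i.e. `Ad(U⁻¹)` is the adjoint of `Ad(U)`. [folklore] -/
theorem inner_adC_left (U : G) (x y : ↥(lieC M)) : ⟪adC M U x, y⟫_ℂ = ⟪x, adC M U⁻¹ y⟫_ℂ := by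
  rw [Submodule.coe_inner, Submodule.coe_inner, coe_adC_apply, coe_adC_apply]
  -- go to matrices: `x = vec a`, `y = vec b`, `u = ρ(U)`
  set a := unvecE M.N (x : EuclideanSpace ℂ (Fin M.N × Fin M.N)) with ha
  set b := unvecE M.N (y : EuclideanSpace ℂ (Fin M.N × Fin M.N)) with hb
  have hx : (x : EuclideanSpace ℂ (Fin M.N × Fin M.N)) = vecE M.N a := by rw [ha, vecE_unvecE]
  have hy : (y : EuclideanSpace ℂ (Fin M.N × Fin M.N)) = vecE M.N b := by rw [hb, vecE_unvecE]
  rw [hx, hy, conjE_vecE, conjE_vecE, inner_vecE, inner_vecE, rho_inv_eq_star, star_star,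
    Matrix.star_eq_conjTranspose, Matrix.conjTranspose_mul, Matrix.conjTranspose_mul,
    Matrix.conjTranspose_conjTranspose]
  -- `tr(u aᴴ uᴴ b) = tr(aᴴ uᴴ b u)`: cyclicity of the trace
  simp only [mul_assoc]
  rw [Matrix.trace_mul_comm (M.ρ U)]
  simp only [mul_assoc]

/-- **No `Ad(G)`-fixed vector in the carrier `𝔤ᶜ`** (vector form of the detecting property), from
`eq_zero_of_mem_span_of_conj_eq`. [cite: Balaban1985UV3, (31)–(32) p.264] -/
theorem adC_eq_self_imp (w : ↥(lieC M)) (hw : ∀ U : G, adC M U w = w) : w = 0 := by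
  have hmat : unvecE M.N (w : EuclideanSpace ℂ (Fin M.N × Fin M.N)) = 0 := by
    refine eq_zero_of_mem_span_of_conj_eq M (unvecE_mem_span_of_mem_lieC M w.2) fun U => ?_
    have h := congrArg (fun z : ↥(lieC M) => unvecE M.N (z : EuclideanSpace ℂ (Fin M.N × Fin M.N))) (hw U)
    simp only [coe_adC_apply, conjE_apply, unvecE_vecE] at h
    rw [← mul_assoc] at h
    exact h
  have : (w : EuclideanSpace ℂ (Fin M.N × Fin M.N)) = 0 := by
    rw [← vecE_unvecE (w : EuclideanSpace ℂ (Fin M.N × Fin M.N)), hmat, map_zero]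
  exact Subtype.ext this

end carrier

/-! ## §3 The detecting property in covector form for the group model (the `hdet` binder of seat p6) -/

section hdet

variable {G : Type} [GaugeGroup G] [MeasurableSpace G] (M : GroupModel G)
  {F : Type*} [NormedAddCommGroup F] [NormedSpace ℂ F]

/-- **«The only element invariant is 0» (p. 264 L6–7), covector form on `𝔤ᶜ`, for the spine's group model AS TYPED**:
every continuous complex-linear map `φ : 𝔤ᶜ → F` with `φ ∘ Ad(ρ U) = φ` for all `U ∈ G` vanishes.  This is LITERALLY the
hypothesis `hdet` of seat p6's `Eq32FromInvariance.fderiv_eq_zero_of_diagInvariant` / `detecting_pi` /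
`Run3Representation.eq32_of_inv26` at `V := ↥(lieC M)`, `π := adC M` — so (31) ⇒ (32) in the chart space follows for every
chart function invariant under the diagonal `Ad(G)`-action ((26)), with NO complex-semisimplicity hypothesis on `𝔤ᶜ`:
the inputs are `GroupModel.semisimple` (real), `GroupModel.mem_unitary`, `GroupModel.mem_lie_iff` (§1 unitary trick +
§2–§3).  «It is the only place we use the semi-simplicity» (p. 264 L9). [cite: Balaban1985UV3, (31)–(32) p.264] -/
theorem hdet_lieC (φ : ↥(lieC M) →L[ℂ] F) (hφ : ∀ U : G, φ.comp (adC M U) = φ) : φ = 0 :=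
  invariantCLM_eq_zero_of_forall_inner (V := ↥(lieC M)) (F := F) (Γ := G) (fun U => adC M U)
    (fun U => ⟨U⁻¹, inner_adC_left M U⟩) (adC_eq_self_imp M) φ hφ

/-- The same for the DIAGONAL action on a chart space `ι → 𝔤ᶜ` of bond variables (seat p6's packaging
`ContinuousLinearMap.pi fun b => (π U).comp (proj b)`), so that `Eq32FromInvariance.fderiv_eq_zero_of_invariant` applies to
`E := ι → ↥(lieC M)` with no residual hypothesis. [cite: Balaban1985UV3, (31)–(32) p.264] -/
theorem hdet_lieC_pi {ι : Type*} [Fintype ι] [DecidableEq ι] (φ : (ι → ↥(lieC M)) →L[ℂ] F)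
    (hφ : ∀ U : G, φ.comp (ContinuousLinearMap.pi fun b => (adC M U).comp (ContinuousLinearMap.proj b)) = φ) :
    φ = 0 := by
  -- bond by bond (as in seat p6's `detecting_pi`, re-proved here to keep this file free of cross-seat imports)
  have hcomp : ∀ b, φ.comp (ContinuousLinearMap.single ℂ (fun _ : ι => ↥(lieC M)) b) = 0 := fun b => by
    refine hdet_lieC M _ fun U => ?_
    ext v
    have h := congrArg (fun S : (ι → ↥(lieC M)) →L[ℂ] F => S (Pi.single b v)) (hφ U)
    simp only [ContinuousLinearMap.comp_apply] at h
    have hT : (ContinuousLinearMap.pi fun b' => (adC M U).comp (ContinuousLinearMap.proj b')) (Pi.single b v)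
        = Pi.single b (adC M U v) := by
      ext b'
      rcases eq_or_ne b' b with rfl | hne
      · simp
      · simp [Pi.single_eq_of_ne hne]
    rw [hT] at h
    simpa using h
  ext B
  have hB : B = ∑ b, Pi.single b (B b) := by
    ext b'; simp [Finset.sum_apply, Pi.single_apply]
  show φ B = 0
  rw [hB, map_sum]
  refine Finset.sum_eq_zero fun b _ => ?_
  have := congrArg (fun S : ↥(lieC M) →L[ℂ] F => S (B b)) (hcomp b)
  simpa using this

end hdet

end Summit.QuantumFields.Balaban3D.Proofs.GroupModelLieC

end
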